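import Summits.QuantumFields.YangMills.Theorems.BalabanUVNodesN20AtRecord12
import Literature.MathematicalPhysics.QuantumFieldTheory.Balaban1983to89.Node00.Record13CoPH

/-!
# YM-DAG node N20 (= NE7b) AT NODE 00's RE-BASED `CoPH`-KEYED STAGE-13 RECORD `Node00.IsRecordOfRecord₁₃CCoPH` (`Node00/Record13CoPH.lean`): the K5 stub `YMDAG.UVSplit.S_N20 SRec` for spine-carrier
# predicates TYPED OVER IT — THE v1.7 `CoPH` EDITION of dag-n20-d's module 3 `…N20AtRecord13` (p489365 ‴; ⁗ p507935 filed by dag-n27-c for the n20 lineage on dag-lead DEDUP-259), filed for the n20 lineage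
# on dag-lead DEDUP-265∕266 (one declarer by lineage; provenance: dag-n20-d `…N20AtRecord11∕12∕13`); mechanical re-key of the ‴ tree bytes, namespace unchanged
# (cell `pub-ymgap`, HUMAN RULING D-0062 Track A, R134 seat `pub-ymgap-dag-n27-c` (s2) gen 9; `--kind proof --supports <K3 id of record> --as helper`; COUNT-NEUTRAL; `N`-generic, NO Theses import)

WHY THIS EDITION (v1.7 `CoPH` = RECORD 13 WITH THE HISTORY-INDEXED RESIDUAL 𝐓-WEIGHT SLOT `Zh p n Ω Λ` (+ the history-indexed §2 smearing `Phih`) — FINDING №9, director-ym №183 H1ʰ ∕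
№186 DESIGN (α) WHOLE-HISTORY ∕ №190 PRESS WORD; def-T FILE 27 `Node00/Record13CoPH.lean` p537939 ✓ + 28T `Node00/Record13SepCoPH.lean` p539169 ✓, RR-2 `Node00/Record13DatumKeyCoPH.lean` ∕
`…KeySepCoPH.lean` ✓ (guard `unityNondeg₁₃H`); route rev 24∕25, dag-lead WORDS-143: K3⁷ `SpineGivenEndpointR13SepCoPH` = stmt-QuantumFields-20544, the ⁶ items aside): this file is the T₇ image of my v1.6
storey `…N20AtRecord13CoPR` (p533300 ✓), which STANDS as a landed sibling — binder `θ : Node00.Stage13RParams F N ↦ θ : Node00.Stage13HParams F N` (`extends Stage13RParams` by the fields `Zh`, `Phih`),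
core provisos `θ.Provisos₁₃CoPR ↦ θ.Provisos₁₃CoPH` (rows `zhLaws ∕ zhLocal`), datum ∕ tower ∕ record ∕ shadow ∕ faces `…₁₃CoPR ↦ …₁₃CoPH` (`datumOfRecord₁₃CoPH θ h` reads the history's
𝐓-weights `WtOfRecord₁₃H θ p s`), guard `θ.ZrUnity ↦ θ.ZhUnity` (RR-2 `unityNondeg₁₃R ↦ unityNondeg₁₃H`), RR-2's ∕ the carriers' ∕ my stems `CoPR ↦ CoPH`; the two SITE-RULE sites of the v1.6
image (`u3OfRecord₁₃ θ.toStage13Params`, the θ-level junction `n18At_u3OfRecord₁₃_readingAdm_iff θ.toStage13Params`) are UNCHANGED — `θ.toStage13Params`, `θ.γ`, `θ.τ9`, `θ.Admissible`,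
`θ.SlotsNondegenerate₁₃`, `θ.toStage12Params` resolve through the two-level `extends`.  bg-BLIND and proviso-FIELD-blind as before: the provisos enter ONLY as the binder type
`hc : θ.Provisos₁₃CoPH F N` and inside `datumOfRecord₁₃CoPH F N θ hc` (keyed ONCE; the item edition's tuple `(θ, h : θ.Provisos₁₃SepCoPH F N)` applies it at `hc := h.toCore`, datum `rfl` by
def-T's `datumOfRecord₁₃SepCoPH_eq_coPH`).  Statements AND proofs = the v1.6 module's, token for token under T₇; NO bridge to ∕ from the v1.6 storeys is stated (different data: `Zh p n Ω Λ`
per history vs `Zr p` per run; the ONE-WAY door ⁶ → ⁷ is def-T's `Stage13HParams.ofHistoryBlind`).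

THE POINT (as at ₁₁ ∕ ₁₂).  `S_N20 SRec := ∀ F D g₀ os S, SRec F D g₀ os S → T4WeightBudget.RelWeightBound S.l₀ S.T S.A S.B S.Bad S.W` reads the record ONLY through
the SET OF BUNDLES `SRec` pins (p450743 `s_N20_iff_forall_pinned`: N20 is DATUM-BLIND).  A predicate KEYED at ₁₃ by a reading
`cr : (F, θ, hP, g₀, os) ↦ SpineCarriers` (READINGS TAKE THE PROVISOS `hP : θ.Provisos₁₃CoPH F N`) pins exactly the bundles `cr F θ hP g₀ os` at `datumOfRecord₁₃CoPH F N θ hP`.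
No `Node00/` reading of Bałaban's DRESSED two-run history expansion off the Stage-13 tuples exists today: `cr` is a PARAMETER of every statement below (the
(T-SPINE) file of record at ₁₃ keys it as `SRec₁₃CoPH cr`).

WHAT THIS MODULE PROVES (all [bookkeeping]; the ₁₂ module's §1–§5 with `12 ↦ 13`).
* §1 `s_N20_keyed₁₃CoPH_iff` (THE RE-KEY AT ₁₃) · `s_N20_of_keyed₁₃CoPH` · `s_N20_of_stage13CoPH_slot`.
* §2 CLOSERS RE-KEYED OVER θ, BY NAME (dag-n20-a's producers): `s_N20_keyed₁₃CoPH_of_extractionLaws` · `s_N20_keyed₁₃CoPH_of_majorant` · `s_N20_keyed₁₃CoPH_of_weightSlot`.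
* §3 THE E1∕E2 DICTIONARY AT THE ₁₃ DATUM: `schemeZ_pos_datumOfRecord₁₃CoPH` (HYPOTHESIS-FREE: `Node00.isPrintedAveraged_datumOfRecord₁₃CoPH`, then n27-a's
  `schemeZ_scheme_pos`) · `badWeight_le_schemeZ_datumOfRecord₁₃CoPH_left ∕ _right` (NE7b AS THE ₁₃ SENTENCE) · `goodTotal_pos_datumOfRecord₁₃CoPH` ·
  `classes_nonempty_datumOfRecord₁₃CoPH`.
* §4 NON-VACUITY ⟺ K0's BODY AT `N`: `s_N20_keyed₁₃CoPH_of_uninhabited` · `exists_pinned_keyed₁₃CoPH_of_inhabited` · `relWeightBound_keyed₁₃CoPH_of_isRecordOfRecord₁₃CCoPH`.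
* §5 SHADOW: `s_N20_keyed₁₃CoPH_iff_shadow₅` — the same reading keyed to def-T's ₅C shadow `datumOfRecord₅ F N (shadow₅OfRecord₁₃CoPH F N θ hP γ')` gives THE SAME `S_N20`.

HONEST FRAMING.  NE7b is NOT PRINTED ([Balaban1989LargeFieldII] (1.79)–(1.89) pp. 383–387 display the KIND of extraction per pinned old genealogy for ONE
run; the summable relative COUNT is the cell's) and NOT PROVED; no inhabitant of `IsRecordOfRecord₁₃CCoPH` is claimed (K0 open); no reading `cr` of Bałaban's
history expansion off θ exists in the tree ((A1c) object); every extraction law, count and majorant below is a HYPOTHESIS on the reading; nothing of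
Bałaban's is asserted or instantiated; N20 is NOT discharged (0∕1 at every record); typed 28∕28, discharged count untouched; one finite four-torus programme
at fixed `ε` — NOT ℝ⁴, NOT infinite volume, NOT OS, NOT a mass gap, NOT Clay.  No decl below carries a cite tag.
-/


open Finset

namespace Summit.QuantumFields.YangMills.Theorems.N20AtRecord13

open Literature.MathematicalPhysics.QuantumFieldTheory.Balaban1983to89
open Literature.MathematicalPhysics.QuantumFieldTheory.Balaban1983to89.T4Continuum
open T4WeightBudget (RelWeightBound)
open Summit.QuantumFields.BalabanUV.T4Continuum.NE7b.PinnedExtraction (ExtractionLaws)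
open Summit.QuantumFields.YangMills.BalabanUVNodes.N20Knit (relWeightBound_of_extractionLaws relWeightBound_of_extractionLaws_majorant
  relWeightBound_mono_weight)
open Summit.QuantumFields.YangMills.Theorems.N20AtSpineCarriers (s_N20_of_empty)
open Summit.QuantumFields.YangMills.Theorems.BalabanUVNodesN27SpineRecord (schemeZ_scheme_pos goodTotal_pos_of_E1 classes_nonempty_of_E1)
open Summit.QuantumFields.YangMills.Theorems.N20AtRecord11 (s_N20_iff_forall_pinned s_N20_of_image)
open YMDAG.UVSplit (Datum SpineCarriers SpineRecordPred S_N20)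
open Node00 (Stage13HParams datumOfRecord₁₃CoPH IsRecordOfRecord₁₃CCoPH)

variable {N : ℕ} [NeZero N]

/-! ## §1 `S_N20` at a predicate KEYED at the ₁₃ record -/

section Keyed

-- `cr`: a READING of spine carriers off NODE 00's Stage-13 parameter tuples WITH PROVISOS (a PARAMETER of this module: no such reading of
-- Bałaban's history expansion exists in the tree).
variable (cr : (F : T4Family) → (θ : Stage13HParams F N) → θ.Provisos₁₃CoPH F N → (ℕ → ℝ) → List (ULoop F) → SpineCarriers)

/-- **THE RE-KEY AT ₁₃.**  Let `SRec` be KEYED at the Stage-13 record by the reading `cr`: it pins, at `(F, D, g₀, os)`, exactly the bundles `cr F θ hP g₀ os`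
of the ADMISSIBLE Stage-13 parameter tuples `θ` WITH PROVISOS `hP` whose datum of record IS `D` (`D = Node00.datumOfRecord₁₃CoPH F N θ hP` — the datum clause of
`Node00.IsRecordOfRecord₁₃CCoPH`).  Then `S_N20 SRec` is EXACTLY the statement «for every family, every admissible Stage-13 `θ` with its provisos, every bare
sequence `g₀` and every loop string `os`, NE7b's `RelWeightBound` holds at the carriers `cr F θ hP g₀ os`» — N20 as a property of NODE 00's Stage-13 objects
of record. [bookkeeping] -/
theorem s_N20_keyed₁₃CoPH_iff (SRec : SpineRecordPred N)
    (hkey : ∀ (F : T4Family) (D : Datum F N) (g₀ : ℕ → ℝ) (os : List (ULoop F)) (S : SpineCarriers), SRec F D g₀ os S ↔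
      ∃ (θ : Stage13HParams F N) (hP : θ.Provisos₁₃CoPH F N), θ.Admissible F N ∧ D = datumOfRecord₁₃CoPH F N θ hP ∧ S = cr F θ hP g₀ os) :
    S_N20 SRec ↔ ∀ (F : T4Family) (θ : Stage13HParams F N) (hP : θ.Provisos₁₃CoPH F N), θ.Admissible F N → ∀ (g₀ : ℕ → ℝ) (os : List (ULoop F)),
      RelWeightBound (cr F θ hP g₀ os).l₀ (cr F θ hP g₀ os).T (cr F θ hP g₀ os).A (cr F θ hP g₀ os).B (cr F θ hP g₀ os).Bad
        (cr F θ hP g₀ os).W := by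
  constructor
  · intro h F θ hP hθ g₀ os
    exact h F (datumOfRecord₁₃CoPH F N θ hP) g₀ os (cr F θ hP g₀ os) ((hkey F _ g₀ os _).mpr ⟨θ, hP, hθ, rfl, rfl⟩)
  · intro h F D g₀ os S hS
    obtain ⟨θ, hP, hθ, -, rfl⟩ := (hkey F D g₀ os S).mp hS
    exact h F θ hP hθ g₀ os

/-- **ONE-SIDED KEY suffices for the closer direction**: if every pinned bundle IS the reading of some admissible Stage-13 θ with provisos realising the datum
(the `→` half of the key), NE7b at every reading gives `S_N20 SRec`. [bookkeeping] -/
theorem s_N20_of_keyed₁₃CoPH (SRec : SpineRecordPred N)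
    (hkey : ∀ (F : T4Family) (D : Datum F N) (g₀ : ℕ → ℝ) (os : List (ULoop F)) (S : SpineCarriers), SRec F D g₀ os S →
      ∃ (θ : Stage13HParams F N) (hP : θ.Provisos₁₃CoPH F N), θ.Admissible F N ∧ D = datumOfRecord₁₃CoPH F N θ hP ∧ S = cr F θ hP g₀ os)
    (h : ∀ (F : T4Family) (θ : Stage13HParams F N) (hP : θ.Provisos₁₃CoPH F N), θ.Admissible F N → ∀ (g₀ : ℕ → ℝ) (os : List (ULoop F)),
      RelWeightBound (cr F θ hP g₀ os).l₀ (cr F θ hP g₀ os).T (cr F θ hP g₀ os).A (cr F θ hP g₀ os).B (cr F θ hP g₀ os).Bad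
        (cr F θ hP g₀ os).W) :
    S_N20 SRec := by
  intro F D g₀ os S hS
  obtain ⟨θ, hP, hθ, -, rfl⟩ := hkey F D g₀ os S hS
  exact h F θ hP hθ g₀ os

end Keyed

/-- **(W2) CLOSER — `S_N20 SRec` FOR EVERY SPINE-CARRIER PREDICATE TYPED OVER THE STAGE-13 RECORD WITH THE BOUND**: if every bundle `S` of record for
`(F, D, g₀, os)` comes with an admissible Stage-13 witness θ WITH ITS PROVISOS realising `D` and NE7b's `RelWeightBound` at `S`'s own carriers, then
`S_N20 SRec`.  The θ-witness is DISPLAYED, not used: N20 reads nothing of the datum (p450743 §1). [bookkeeping] -/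
theorem s_N20_of_stage13CoPH_slot (SRec : SpineRecordPred N)
    (hslot : ∀ (F : T4Family) (D : Datum F N) (g₀ : ℕ → ℝ) (os : List (ULoop F)) (S : SpineCarriers), SRec F D g₀ os S →
      ∃ (θ : Stage13HParams F N) (hP : θ.Provisos₁₃CoPH F N), θ.Admissible F N ∧ D = datumOfRecord₁₃CoPH F N θ hP ∧
        RelWeightBound S.l₀ S.T S.A S.B S.Bad S.W) :
    S_N20 SRec := by
  intro F D g₀ os S hS
  obtain ⟨θ, hP, -, -, h⟩ := hslot F D g₀ os S hS
  exact h

/-! ## §2 The closers of p421432 RE-KEYED over NODE 00's Stage-13 parameter tuples (dag-n20-a's producers BY NAME) -/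

section Closers

variable (cr : (F : T4Family) → (θ : Stage13HParams F N) → θ.Provisos₁₃CoPH F N → (ℕ → ℝ) → List (ULoop F) → SpineCarriers)

/-- **`S_N20` AT ₁₃ FROM TWO RUNS' EXTRACTION LAWS AT THE READING'S EXACT CARRIERS.**  At a predicate keyed at ₁₃ by `cr` (one-sided key): if for every
admissible Stage-13 θ with provisos and every `(g₀, os)` the reading `S := cr F θ hP g₀ os` carries the two runs' `PinnedExtraction.ExtractionLaws` over
`S.T`, `S.Bad` (pinned classes, sub-classes, source-uniform quotients — the H3^NE7b display of (1.79)–(1.89)'s KIND), nonnegative weights, quotient totals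
`≤ S.W K` in both runs, `S.W K < 1` and `Summable S.W`, then `S_N20 SRec` — `N20Knit.relWeightBound_of_extractionLaws` BY NAME at θ's reading.  (What a
₁₃ reading `cr` of Bałaban's expansion must deliver for N20, row by row.) [bookkeeping] -/
theorem s_N20_keyed₁₃CoPH_of_extractionLaws (SRec : SpineRecordPred N)
    (hkey : ∀ (F : T4Family) (D : Datum F N) (g₀ : ℕ → ℝ) (os : List (ULoop F)) (S : SpineCarriers), SRec F D g₀ os S →
      ∃ (θ : Stage13HParams F N) (hP : θ.Provisos₁₃CoPH F N), θ.Admissible F N ∧ D = datumOfRecord₁₃CoPH F N θ hP ∧ S = cr F θ hP g₀ os)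
    (hrows : ∀ (F : T4Family) (θ : Stage13HParams F N) (hP : θ.Provisos₁₃CoPH F N), θ.Admissible F N → ∀ (g₀ : ℕ → ℝ) (os : List (ULoop F)),
      ∃ (α α' : Type) (X : ℕ → Finset α) (Badx : ℕ → α → Finset (cr F θ hP g₀ os).ι) (q : ℕ → α → ℝ)
        (X' : ℕ → Finset α') (Badx' : ℕ → α' → Finset (cr F θ hP g₀ os).ι) (q' : ℕ → α' → ℝ),
        ExtractionLaws (cr F θ hP g₀ os).l₀ (cr F θ hP g₀ os).T (cr F θ hP g₀ os).A (cr F θ hP g₀ os).Bad X Badx q ∧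
        ExtractionLaws (cr F θ hP g₀ os).l₀ (cr F θ hP g₀ os).T (cr F θ hP g₀ os).B (cr F θ hP g₀ os).Bad X' Badx' q' ∧
        (∀ (K : ℕ) (t : ℝ), |t| ≤ (cr F θ hP g₀ os).l₀ → ∀ τ, 0 ≤ (cr F θ hP g₀ os).A K t τ) ∧
        (∀ (K : ℕ) (t : ℝ), |t| ≤ (cr F θ hP g₀ os).l₀ → ∀ τ, 0 ≤ (cr F θ hP g₀ os).B K t τ) ∧
        (∀ K, ∑ x ∈ X K, q K x ≤ (cr F θ hP g₀ os).W K) ∧ (∀ K, ∑ x ∈ X' K, q' K x ≤ (cr F θ hP g₀ os).W K) ∧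
        (∀ K, (cr F θ hP g₀ os).W K < 1) ∧ Summable (cr F θ hP g₀ os).W) :
    S_N20 SRec := by
  refine s_N20_of_keyed₁₃CoPH cr SRec hkey fun F θ hP hθ g₀ os => ?_
  obtain ⟨α, α', X, Badx, q, X', Badx', q', hA, hB, hA0, hB0, hWA, hWB, h1, hs⟩ := hrows F θ hP hθ g₀ os
  exact relWeightBound_of_extractionLaws hA hB hA0 hB0 hWA hWB h1 hs

/-- **`S_N20` AT ₁₃ UNDER THE TWO-RATE MAJORANT.**  As `s_N20_keyed₁₃CoPH_of_extractionLaws` with the COUNT in two-rate currency — quotient totals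
`≤ V·r^{K − j⋆(K)}` in both runs, `0 < r < 1`, `0 ≤ V`, a positive fraction `c·K ≤ K − j⋆(K)` of old steps, `V·r^{K − j⋆(K)} < 1` at every `K` — and the
reading's slot `(cr F θ hP g₀ os).W = (K ↦ V·r^{K − j⋆(K)})` (letters may depend on θ, `g₀`, `os`): `N20Knit.relWeightBound_of_extractionLaws_majorant` BY NAME.
[bookkeeping] -/
theorem s_N20_keyed₁₃CoPH_of_majorant (SRec : SpineRecordPred N)
    (hkey : ∀ (F : T4Family) (D : Datum F N) (g₀ : ℕ → ℝ) (os : List (ULoop F)) (S : SpineCarriers), SRec F D g₀ os S →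
      ∃ (θ : Stage13HParams F N) (hP : θ.Provisos₁₃CoPH F N), θ.Admissible F N ∧ D = datumOfRecord₁₃CoPH F N θ hP ∧ S = cr F θ hP g₀ os)
    (hrows : ∀ (F : T4Family) (θ : Stage13HParams F N) (hP : θ.Provisos₁₃CoPH F N), θ.Admissible F N → ∀ (g₀ : ℕ → ℝ) (os : List (ULoop F)),
      ∃ (α α' : Type) (X : ℕ → Finset α) (Badx : ℕ → α → Finset (cr F θ hP g₀ os).ι) (q : ℕ → α → ℝ)
        (X' : ℕ → Finset α') (Badx' : ℕ → α' → Finset (cr F θ hP g₀ os).ι) (q' : ℕ → α' → ℝ) (r V c : ℝ) (jstar : ℕ → ℕ),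
        ExtractionLaws (cr F θ hP g₀ os).l₀ (cr F θ hP g₀ os).T (cr F θ hP g₀ os).A (cr F θ hP g₀ os).Bad X Badx q ∧
        ExtractionLaws (cr F θ hP g₀ os).l₀ (cr F θ hP g₀ os).T (cr F θ hP g₀ os).B (cr F θ hP g₀ os).Bad X' Badx' q' ∧
        (∀ (K : ℕ) (t : ℝ), |t| ≤ (cr F θ hP g₀ os).l₀ → ∀ τ, 0 ≤ (cr F θ hP g₀ os).A K t τ) ∧
        (∀ (K : ℕ) (t : ℝ), |t| ≤ (cr F θ hP g₀ os).l₀ → ∀ τ, 0 ≤ (cr F θ hP g₀ os).B K t τ) ∧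
        0 < r ∧ r < 1 ∧ 0 ≤ V ∧ 0 < c ∧ (∀ K : ℕ, c * K ≤ ((K - jstar K : ℕ) : ℝ)) ∧
        (∀ K, ∑ x ∈ X K, q K x ≤ V * r ^ (K - jstar K)) ∧ (∀ K, ∑ x ∈ X' K, q' K x ≤ V * r ^ (K - jstar K)) ∧
        (∀ K, V * r ^ (K - jstar K) < 1) ∧ (cr F θ hP g₀ os).W = fun K => V * r ^ (K - jstar K)) :
    S_N20 SRec := by
  refine s_N20_of_keyed₁₃CoPH cr SRec hkey fun F θ hP hθ g₀ os => ?_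
  obtain ⟨α, α', X, Badx, q, X', Badx', q', r, V, c, jstar, hA, hB, hA0, hB0, h0, hr1, hV, hc, hfrac, hmajA, hmajB, hlt, hW⟩ :=
    hrows F θ hP hθ g₀ os
  rw [hW]
  exact relWeightBound_of_extractionLaws_majorant hA hB hA0 hB0 h0 hr1 hV hc hfrac hmajA hmajB hlt

/-- **`S_N20` AT ₁₃ FOR A WEIGHT-SLOT READING.**  If at every admissible Stage-13 θ with provisos the reading carries NE7b with SOME witness weight `W′`
dominated by its slot (`W′ K ≤ (cr …).W K`), the slot `< 1` and summable, and termwise nonnegative weights on the classes, then `S_N20 SRec` —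
`N20Knit.relWeightBound_mono_weight` BY NAME (the slot of record is a pinned majorant of what a witness road delivers). [bookkeeping] -/
theorem s_N20_keyed₁₃CoPH_of_weightSlot (SRec : SpineRecordPred N)
    (hkey : ∀ (F : T4Family) (D : Datum F N) (g₀ : ℕ → ℝ) (os : List (ULoop F)) (S : SpineCarriers), SRec F D g₀ os S →
      ∃ (θ : Stage13HParams F N) (hP : θ.Provisos₁₃CoPH F N), θ.Admissible F N ∧ D = datumOfRecord₁₃CoPH F N θ hP ∧ S = cr F θ hP g₀ os)
    (hrows : ∀ (F : T4Family) (θ : Stage13HParams F N) (hP : θ.Provisos₁₃CoPH F N), θ.Admissible F N → ∀ (g₀ : ℕ → ℝ) (os : List (ULoop F)),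
      ∃ W' : ℕ → ℝ,
        RelWeightBound (cr F θ hP g₀ os).l₀ (cr F θ hP g₀ os).T (cr F θ hP g₀ os).A (cr F θ hP g₀ os).B (cr F θ hP g₀ os).Bad W' ∧
        (∀ K, W' K ≤ (cr F θ hP g₀ os).W K) ∧ (∀ K, (cr F θ hP g₀ os).W K < 1) ∧ Summable (cr F θ hP g₀ os).W ∧
        (∀ (K : ℕ) (t : ℝ), |t| ≤ (cr F θ hP g₀ os).l₀ → ∀ τ ∈ (cr F θ hP g₀ os).T K, 0 ≤ (cr F θ hP g₀ os).A K t τ) ∧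
        (∀ (K : ℕ) (t : ℝ), |t| ≤ (cr F θ hP g₀ os).l₀ → ∀ τ ∈ (cr F θ hP g₀ os).T K, 0 ≤ (cr F θ hP g₀ os).B K t τ)) :
    S_N20 SRec := by
  refine s_N20_of_keyed₁₃CoPH cr SRec hkey fun F θ hP hθ g₀ os => ?_
  obtain ⟨W', hW', hle, h1, hs, hA, hB⟩ := hrows F θ hP hθ g₀ os
  exact relWeightBound_mono_weight hW' hle h1 hs hA hB

end Closers

/-! ## §3 Where the ₁₃ objects enter N20: the E1∕E2 dictionary at the Stage-13 datum `datumOfRecord₁₃CoPH F N θ hP` -/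

section Dictionary

variable {F : T4Family}

/-- **THE DRESSED PARTITION FUNCTIONS OF A STAGE-13 DATUM ARE POSITIVE — no hypothesis.**  For every Stage-13 parameter tuple θ with provisos, every bare
sequence `g₀`, loop string `os`, cutoff `K` and source `t`: `0 < schemeZ ((datumOfRecord₁₃CoPH F N θ hP).scheme g₀) os K t` (binder B1 at the ₁₃ datum,
`Node00.isPrintedAveraged_datumOfRecord₁₃CoPH`, gives measurable averaging maps; then n27-a's `schemeZ_scheme_pos`: ferromagnetic Wilson weight, `1`-bounded
measurable observables).  So at ₁₃ the left side of the E1∕E2 dictionary is a genuine positive number built from the densities of record. [bookkeeping] -/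
theorem schemeZ_pos_datumOfRecord₁₃CoPH (θ : Stage13HParams F N) (hP : θ.Provisos₁₃CoPH F N) (g₀ : ℕ → ℝ) (os : List (ULoop F)) (K : ℕ) (t : ℝ) :
    0 < T4GenFunBounds.schemeZ ((datumOfRecord₁₃CoPH F N θ hP).scheme g₀) os K t :=
  schemeZ_scheme_pos (datumOfRecord₁₃CoPH F N θ hP) (Node00.isPrintedAveraged_datumOfRecord₁₃CoPH F N θ hP).avgMeasurable g₀ os K t

/-- **NE7b AS THE ₁₃ SENTENCE, run A.**  If a bundle `S` pinned at the Stage-13 datum of θ satisfies run A's dictionary E1 there (its class sums ARE the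
dressed partition functions of the string after `S.K₀ + K` steps on `|t| ≤ S.l₀`, the `S_N27x` clause) and NE7b's `RelWeightBound`, then at every cutoff
and source the PERSISTENT-ACTIVITY CLASSES CARRY AT MOST THE FRACTION `S.W K` OF THE STRING'S DRESSED PARTITION FUNCTION OF RECORD:
`Σ_{τ ∈ S.Bad K t} S.A K t τ ≤ S.W K · schemeZ ((datumOfRecord₁₃CoPH F N θ hP).scheme g₀) os (S.K₀ + K) t`. [bookkeeping] -/
theorem badWeight_le_schemeZ_datumOfRecord₁₃CoPH_left (θ : Stage13HParams F N) (hP : θ.Provisos₁₃CoPH F N) (g₀ : ℕ → ℝ) (os : List (ULoop F))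
    (S : SpineCarriers)
    (hE1 : ∀ (K : ℕ) (t : ℝ), |t| ≤ S.l₀ →
      T4GenFunBounds.schemeZ ((datumOfRecord₁₃CoPH F N θ hP).scheme g₀) os (S.K₀ + K) t = ∑ τ ∈ S.T K, S.A K t τ)
    (h20 : RelWeightBound S.l₀ S.T S.A S.B S.Bad S.W) (K : ℕ) (t : ℝ) (ht : |t| ≤ S.l₀) :
    ∑ τ ∈ S.Bad K t, S.A K t τ ≤ S.W K * T4GenFunBounds.schemeZ ((datumOfRecord₁₃CoPH F N θ hP).scheme g₀) os (S.K₀ + K) t := by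
  rw [hE1 K t ht]
  exact h20.bad_left K t ht

/-- **NE7b AS THE ₁₃ SENTENCE, run B** (dictionary E2: class sums = the dressed partition functions after `S.K₀ + K + 1` steps). [bookkeeping] -/
theorem badWeight_le_schemeZ_datumOfRecord₁₃CoPH_right (θ : Stage13HParams F N) (hP : θ.Provisos₁₃CoPH F N) (g₀ : ℕ → ℝ) (os : List (ULoop F))
    (S : SpineCarriers)
    (hE2 : ∀ (K : ℕ) (t : ℝ), |t| ≤ S.l₀ →
      T4GenFunBounds.schemeZ ((datumOfRecord₁₃CoPH F N θ hP).scheme g₀) os (S.K₀ + K + 1) t = ∑ τ ∈ S.T K, S.B K t τ)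
    (h20 : RelWeightBound S.l₀ S.T S.A S.B S.Bad S.W) (K : ℕ) (t : ℝ) (ht : |t| ≤ S.l₀) :
    ∑ τ ∈ S.Bad K t, S.B K t τ ≤ S.W K * T4GenFunBounds.schemeZ ((datumOfRecord₁₃CoPH F N θ hP).scheme g₀) os (S.K₀ + K + 1) t := by
  rw [hE2 K t ht]
  exact h20.bad_right K t ht

/-- **THE GOOD CLASSES ARE PROPER AT A STAGE-13 DATUM.**  Under E1 at the ₁₃ datum and NE7b, the GOOD part `S.T K ∖ S.Bad K t` carries POSITIVE total weight
at every cutoff and `|t| ≤ S.l₀` — n27-a's `goodTotal_pos_of_E1` BY NAME, its hypothesis `D.AvgMeasurable` DISCHARGED at ₁₃ by B1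
(`Node00.isPrintedAveraged_datumOfRecord₁₃CoPH`). [bookkeeping] -/
theorem goodTotal_pos_datumOfRecord₁₃CoPH (θ : Stage13HParams F N) (hP : θ.Provisos₁₃CoPH F N) (g₀ : ℕ → ℝ) (os : List (ULoop F)) (S : SpineCarriers)
    (hE1 : ∀ (K : ℕ) (t : ℝ), |t| ≤ S.l₀ →
      T4GenFunBounds.schemeZ ((datumOfRecord₁₃CoPH F N θ hP).scheme g₀) os (S.K₀ + K) t = ∑ τ ∈ S.T K, S.A K t τ)
    (h20 : RelWeightBound S.l₀ S.T S.A S.B S.Bad S.W) (K : ℕ) {t : ℝ} (ht : |t| ≤ S.l₀) :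
    letI := S.dec; 0 < ∑ τ ∈ S.T K \ S.Bad K t, S.A K t τ := by
  letI := S.dec
  exact goodTotal_pos_of_E1 (datumOfRecord₁₃CoPH F N θ hP) (Node00.isPrintedAveraged_datumOfRecord₁₃CoPH F N θ hP).avgMeasurable g₀ os hE1 h20 K ht

/-- **AN E1-PINNED BUNDLE AT A STAGE-13 DATUM IS NEVER THE EMPTY EXPANSION** (`0 ≤ S.l₀`): every term class `S.T K` is nonempty — n27-a's
`classes_nonempty_of_E1` BY NAME with `D.AvgMeasurable` discharged at ₁₃.  Consequence for a ₁₃ reading of the spine carriers: of p421432's guards the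
vacuity-by-emptiness reading cannot arise once E1 is pinned at the datum; the bad-class traps (`s_N20_of_noBadReading`, the saturated refutation
`not_s_N20_of_admits_saturated`) are the ones to honour. [bookkeeping] -/
theorem classes_nonempty_datumOfRecord₁₃CoPH (θ : Stage13HParams F N) (hP : θ.Provisos₁₃CoPH F N) (g₀ : ℕ → ℝ) (os : List (ULoop F)) (S : SpineCarriers)
    (hl₀ : 0 ≤ S.l₀)
    (hE1 : ∀ (K : ℕ) (t : ℝ), |t| ≤ S.l₀ →
      T4GenFunBounds.schemeZ ((datumOfRecord₁₃CoPH F N θ hP).scheme g₀) os (S.K₀ + K) t = ∑ τ ∈ S.T K, S.A K t τ)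
    (K : ℕ) : (S.T K).Nonempty :=
  classes_nonempty_of_E1 (datumOfRecord₁₃CoPH F N θ hP) (Node00.isPrintedAveraged_datumOfRecord₁₃CoPH F N θ hP).avgMeasurable g₀ os hl₀ hE1 K

end Dictionary

/-! ## §4 Non-vacuity of the ₁₃-typed stub ⟺ the body of K0 at `N`; the consumer face at a Stage-13 record pair -/

/-- **IF THE STAGE-13 RECORD CLASS WERE EMPTY, `S_N20` AT ₁₃ WOULD BE FREE.**  If on no family an admissible Stage-13 parameter tuple satisfies its displayed
provisos (the NEGATION of K0's body at `N` — a HYPOTHESIS here: the Stage-13 provisos carry no located contradiction), a spine-carrier predicate typed over ₁₃CCoPH pins no bundle at all and `S_N20 SRec` holds with no estimate — p421432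
`N20AtSpineCarriers.s_N20_of_empty` BY NAME.  (The ₁₃ knit is worth exactly as much as K0.) [bookkeeping] -/
theorem s_N20_keyed₁₃CoPH_of_uninhabited (SRec : SpineRecordPred N)
    (htyped : ∀ (F : T4Family) (D : Datum F N) (g₀ : ℕ → ℝ) (os : List (ULoop F)) (S : SpineCarriers), SRec F D g₀ os S →
      ∃ (θ : Stage13HParams F N) (hP : θ.Provisos₁₃CoPH F N), θ.Admissible F N ∧ D = datumOfRecord₁₃CoPH F N θ hP)
    (hempty : ∀ (F : T4Family) (θ : Stage13HParams F N), θ.Admissible F N → ¬ θ.Provisos₁₃CoPH F N) :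
    S_N20 SRec :=
  s_N20_of_empty SRec fun F D g₀ os S hS => by
    obtain ⟨θ, hP, hθ, -⟩ := htyped F D g₀ os S hS
    exact hempty F θ hθ hP

section KeyedAtRecord

variable (cr : (F : T4Family) → (θ : Stage13HParams F N) → θ.Provisos₁₃CoPH F N → (ℕ → ℝ) → List (ULoop F) → SpineCarriers)

/-- **UNDER K0's BODY THE ₁₃-KEYED STUB IS NOT THE EMPTY IMPLICATION.**  If the Stage-13 record class is inhabited on every family
(`∀ F, ∃ D w, Node00.IsRecordOfRecord₁₃CCoPH F N D w` — the body of the route's K0 at `N` after the rev-8 restate; an antecedent here, neither proved nor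
assumed elsewhere), then a predicate keyed at ₁₃ by ANY reading `cr` pins, on every family and for every `(g₀, os)`, at least one bundle at a Stage-13 datum
of record (`Node00.exists_provisos_of_isRecordOfRecord₁₃CCoPH`). [bookkeeping] -/
theorem exists_pinned_keyed₁₃CoPH_of_inhabited (SRec : SpineRecordPred N)
    (hkey : ∀ (F : T4Family) (D : Datum F N) (g₀ : ℕ → ℝ) (os : List (ULoop F)) (S : SpineCarriers), SRec F D g₀ os S ↔
      ∃ (θ : Stage13HParams F N) (hP : θ.Provisos₁₃CoPH F N), θ.Admissible F N ∧ D = datumOfRecord₁₃CoPH F N θ hP ∧ S = cr F θ hP g₀ os)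
    (hK0 : ∀ F : T4Family, ∃ (D : Datum F N) (w : DagBinding.WorldP), IsRecordOfRecord₁₃CCoPH F N D w)
    (F : T4Family) (g₀ : ℕ → ℝ) (os : List (ULoop F)) :
    ∃ (D : Datum F N) (w : DagBinding.WorldP) (S : SpineCarriers), IsRecordOfRecord₁₃CCoPH F N D w ∧ SRec F D g₀ os S := by
  obtain ⟨D, w, hR⟩ := hK0 F
  obtain ⟨θ, hP, hθ, hD⟩ := Node00.exists_provisos_of_isRecordOfRecord₁₃CCoPH hR
  exact ⟨D, w, cr F θ hP g₀ os, hR, (hkey F D g₀ os _).mpr ⟨θ, hP, hθ, hD, rfl⟩⟩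

/-- **THE CONSUMER FACE AT A STAGE-13 RECORD PAIR.**  At a predicate keyed at ₁₃ by `cr` with `S_N20 SRec`: every Stage-13 record pair `(D, w)` comes with an
admissible θ with provisos realising `D`, and for every `(g₀, os)` the bundle `cr F θ hP g₀ os` IS PINNED AT THE PAIR'S OWN DATUM and carries NE7b there — the
N20 conjunct the ₁₃ join of N27 consumes next to the extraction stub `S_N27x`'s pinned bundle. [bookkeeping] -/
theorem relWeightBound_keyed₁₃CoPH_of_isRecordOfRecord₁₃CCoPH (SRec : SpineRecordPred N)
    (hkey : ∀ (F : T4Family) (D : Datum F N) (g₀ : ℕ → ℝ) (os : List (ULoop F)) (S : SpineCarriers), SRec F D g₀ os S ↔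
      ∃ (θ : Stage13HParams F N) (hP : θ.Provisos₁₃CoPH F N), θ.Admissible F N ∧ D = datumOfRecord₁₃CoPH F N θ hP ∧ S = cr F θ hP g₀ os)
    (h : S_N20 SRec) {F : T4Family} {D : Datum F N} {w : DagBinding.WorldP} (hR : IsRecordOfRecord₁₃CCoPH F N D w) :
    ∃ (θ : Stage13HParams F N) (hP : θ.Provisos₁₃CoPH F N), θ.Admissible F N ∧ D = datumOfRecord₁₃CoPH F N θ hP ∧
      ∀ (g₀ : ℕ → ℝ) (os : List (ULoop F)), SRec F D g₀ os (cr F θ hP g₀ os) ∧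
        RelWeightBound (cr F θ hP g₀ os).l₀ (cr F θ hP g₀ os).T (cr F θ hP g₀ os).A (cr F θ hP g₀ os).B (cr F θ hP g₀ os).Bad
          (cr F θ hP g₀ os).W := by
  obtain ⟨θ, hP, hθ, hD⟩ := Node00.exists_provisos_of_isRecordOfRecord₁₃CCoPH hR
  refine ⟨θ, hP, hθ, hD, fun g₀ os => ?_⟩
  have hS : SRec F D g₀ os (cr F θ hP g₀ os) := (hkey F D g₀ os _).mpr ⟨θ, hP, hθ, hD, rfl⟩
  exact ⟨hS, h F D g₀ os _ hS⟩

/-! ## §5 The shadow: the same reading keyed to def-T's ₅C shadow datum of the Stage-13 tuple gives the same `S_N20` -/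

/-- **N20 IS INVARIANT UNDER RE-KEYING TO THE ₅C SHADOW OF THE STAGE-13 TUPLE.**  Key the SAME reading `cr` once at the Stage-13 datum
`datumOfRecord₁₃CoPH F N θ hP` (`SRec₁₃CoPH`) and once at def-T's ₅C SHADOW datum `datumOfRecord₅ F N (shadow₅OfRecord₁₃CoPH F N θ hP γ')` of the same θ at any interval
letter `γ'` (`SRec₅` — Record 13 §9: the shadow has the same `C`, `dens`, `βfun`, `av`, and «`IsRecordOfRecord₁₃CCoPH → IsRecordOfRecord₅C` holds AT THE SHADOW,
not at `D`»).  Then `S_N20 SRec₁₃CoPH ↔ S_N20 SRec₅`: both pin the same SET of bundles (p450743 `s_N20_of_image` twice).  So along the shadow road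
(`Node00.exists_isRecordOfRecord₅C_of_isRecordOfRecord₁₃CCoPH`) the N20 conjunct needs no congruence lemma at all. [bookkeeping] -/
theorem s_N20_keyed₁₃CoPH_iff_shadow₅ (SRec₁₃CoPH SRec₅ : SpineRecordPred N)
    (hkey₁₃ : ∀ (F : T4Family) (D : Datum F N) (g₀ : ℕ → ℝ) (os : List (ULoop F)) (S : SpineCarriers), SRec₁₃CoPH F D g₀ os S ↔
      ∃ (θ : Stage13HParams F N) (hP : θ.Provisos₁₃CoPH F N), θ.Admissible F N ∧ D = datumOfRecord₁₃CoPH F N θ hP ∧ S = cr F θ hP g₀ os)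
    (hkey₅ : ∀ (F : T4Family) (D : Datum F N) (g₀ : ℕ → ℝ) (os : List (ULoop F)) (S : SpineCarriers), SRec₅ F D g₀ os S ↔
      ∃ (θ : Stage13HParams F N) (hP : θ.Provisos₁₃CoPH F N) (γ' : ℝ), θ.Admissible F N ∧
        D = Node00.datumOfRecord₅ F N (Node00.shadow₅OfRecord₁₃CoPH F N θ hP γ') ∧ S = cr F θ hP g₀ os) :
    S_N20 SRec₁₃CoPH ↔ S_N20 SRec₅ := by
  constructor
  · refine fun h => s_N20_of_image (fun S ⟨F, D, g₀, os, hS⟩ => ?_) h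
    obtain ⟨θ, hP, γ', hθ, -, rfl⟩ := (hkey₅ F D g₀ os S).mp hS
    exact ⟨F, _, g₀, os, (hkey₁₃ F _ g₀ os _).mpr ⟨θ, hP, hθ, rfl, rfl⟩⟩
  · refine fun h => s_N20_of_image (fun S ⟨F, D, g₀, os, hS⟩ => ?_) h
    obtain ⟨θ, hP, hθ, -, rfl⟩ := (hkey₁₃ F D g₀ os S).mp hS
    exact ⟨F, _, g₀, os, (hkey₅ F _ g₀ os _).mpr ⟨θ, hP, 0, hθ, rfl, rfl⟩⟩

end KeyedAtRecord

end Summit.QuantumFields.YangMills.Theorems.N20AtRecord13
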